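import Literature.Analysis.FluidPDE.TorusClassicalHnBalance
import Literature.Analysis.FunctionSpaces.TorusConvectionGradLaplacianNormSq
import Literature.Analysis.FunctionSpaces.TorusClassicalNSUniqueness
import Literature.Analysis.FunctionSpaces.TorusCalculusProofs
import Literature.Analysis.FunctionSpaces.TorusAgmonExplicit
import Mathlib.MeasureTheory.Integral.Bochner.Basic
import HarnessLib

/-!
# The `N = 2` rung of the Doering–Gibbon ladder on the torus: `½ d/dt ‖Δu‖₂² ≤ −ν‖∇Δu‖₂² + 3‖∇u‖_∞ ‖Δu‖₂²` — PROVED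

Analysis/FluidPDE proof file (theorems only: no definitions, no named facts). The **Navier–Stokes
ladder theorem** of Doering–Gibbon 1995 (Thm 6.1; Step 5 of its proof, eq. (6.2.27)) states, for
space-periodic flows and the seminorms `H_N = ∫ |∇ᴺu|²`,

  `½ Ḣ_N ≤ −ν H_{N+1} + c_N ‖Du‖_∞ H_N + H_N^{1/2} Φ_N^{1/2}`.

This file proves the rung `N = 2` WITHOUT forcing (`Φ = 0`) for classical solutions on the flat torus
`T^d` (any dimension), with the dimensionless constant made explicit, `c₂ = 3`, in the Frobenius
normalisation of `‖Du‖_∞`: if `∑ᵢ ‖∂ᵢu(t,x)‖² ≤ M²` for all `x`, then every one-sided derivative `R` of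
`t ↦ ½‖Δu(t)‖₂²` (`= ½H₂`, since `∫∑ᵢ∑ⱼ‖∂ᵢ∂ⱼu‖² = ∫‖Δu‖²` on the torus) within `[a, b]` satisfies

  `R ≤ −ν ‖∇Δu(t)‖₂² + 3 M ‖Δu(t)‖₂²`   (`‖∇Δu‖₂² = Torus.gradNormSq (Δu) = H₃`)

(`Torus.IsClassicalNSSolutionOn.halfLaplacianSqRate_le_of_gradient_bound`), together with its three
static ingredients as separate theorems: the bound on the nonlinear term
`|∫⟪(v·∇)v, Δ²v⟫| ≤ 3M‖Δv‖₂²` (DG (6.2.25) at `N = 2`, `Torus.abs_integral_inner_convect_bilaplacian_le`),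
the interpolation `‖Δv‖₂⁴ ≤ ‖∇v‖₂²‖∇Δv‖₂²` (DG Lemma 6.2 at `N = 2`,
`Torus.sq_integral_norm_sq_laplacian_le`), and — in `d = 3` — Agmon for the gradient with the explicit
constant, `∑ᵢ‖∂ᵢv(x)‖² ≤ (2/π²)‖Δv‖₂‖∇Δv‖₂` (`Torus.sum_norm_sq_partialDeriv_le_agmon_explicit`). In the
vocabulary of the functional-mining census this is the PALINSTROPHY budget driven by `‖∇u‖_∞` — the
proved, log-free baseline behind the conjectural `‖ω‖_∞`-log form (Beale–Kato–Majda needs a logarithm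
to pass from `‖∇u‖_∞` to `‖ω‖_∞`).

Proof (Doering–Gibbon 1995, §6.2 Steps 1–5 at `N = 2`): the `H²` balance
`½ d/dt‖Δu‖₂² = −ν‖∇Δu‖₂² − ∫⟪(u·∇)u, Δ²u⟫` (tree:
`Torus.IsClassicalNSSolutionOn.hasDerivWithinAt_half_integral_norm_sq_laplacian_iterate`, `n = 1`),
Green `∫⟪B, Δ²u⟫ = ∫⟪ΔB, Δu⟫`, the Leibniz expansion
`Δ((u·∇)u) = (u·∇)Δu + 2∑ₘ(∂ₘu·∇)∂ₘu + (Δu·∇)u` (`Torus.partialDeriv_convect_eq_add_convect` twice),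
the transport identity `∫⟪(u·∇)Δu, Δu⟫ = 0` (`div u = 0`), the pointwise bounds
`|∑ₘ⟪(∂ₘu·∇)∂ₘu, Δu⟫| ≤ M |∇²u|_F ‖Δu‖`, `|⟪(Δu·∇)u, Δu⟫| ≤ M‖Δu‖²`, Cauchy–Schwarz in `L²` and
`‖∇²u‖₂ = ‖Δu‖₂` (`Torus.integral_sum_sum_norm_partialDeriv_partialDeriv_sq_eq`).

## Mathlib / tree search

Tree: `TorusClassicalHnBalance` (the `H²ⁿ` balances), `TorusConvectionLaplacianNormSq` /
`TorusConvectionGradNormSq` (Leibniz for `∂ₘ((v·∇)w)`, Hessian = Laplacian in `L²`),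
`TorusClassicalNSUniqueness` (`Torus.integral_inner_convect_self_right_eq_zero`), `TorusCalculusProofs`
(`Torus.fderiv_apply_eq_sum_partialDeriv`, `Torus.laplacian_eq_sum_partialDeriv_partialDeriv`),
`TorusFluidGlueProofs` (`Torus.integral_inner_laplacian_comm`, `Torus.integral_inner_partialDeriv_eq_neg`),
`TorusEnstrophyOrthogonality` (`Torus.partialDeriv_finset_sum`), `TorusTestFunction` (`Torus.partialDeriv_add`),
`TorusAgmonExplicit` (`Torus.norm_sq_le_two_div_pi_sq_mul_sqrt`), `TorusConvectionGradLaplacianNormSq`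
(`Torus.gradNormSq_laplacian_eq_sum`, `Torus.hasZeroMean_partialDeriv`). The tree's `H²` flux
bound `Torus.IsClassicalNSSolutionOn.laplacian_flux_le_half` (`TorusClassicalH3Balance`) has
existential constants and the `H³` quantity on the right; no `‖∇u‖_∞`-driven `H²` budget (searched
`ladder`, `palinstrophy`, `laplacian_flux`). Mathlib: `Real.sum_mul_le_sqrt_mul_sqrt`,
`integral_mul_le_Lp_mul_Lq_of_nonneg`.

## References

* C. R. Doering, J. D. Gibbon, *Applied Analysis of the Navier–Stokes Equations*, CUP 1995, §6.2,
  Thm 6.1, proof Steps 1–6, eqs. (6.2.12), (6.2.25), (6.2.27), Lemma 6.2 (6.2.28)–(6.2.31)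
  (PDF pp. 98–102). [DoeringGibbon1995]
* D. Ayala, PhD thesis, McMaster University 2014, App. A (A.3) (Agmon on `T³`). [Ayala2014Thesis]
-/

noncomputable section

open MeasureTheory Set Function Real
open scoped InnerProductSpace RealInnerProductSpace

namespace Literature.Analysis.FluidPDE

open Literature.Analysis.FunctionSpaces

variable {d : Type*} [Fintype d] [DecidableEq d]

/-! ## Pointwise tools -/

/-- Pointwise bound of a convective derivative by the Frobenius norm of the gradient:
`‖(a·∇)v (x)‖ ≤ ‖a(x)‖ (∑ᵢ ‖∂ᵢ v(x)‖²)^{1/2}` (`Dv(x)h = ∑ᵢ hᵢ ∂ᵢv(x)`, Cauchy–Schwarz in `ℝ^d`).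
[folklore] -/
private theorem norm_convect_le_norm_mul_sqrt' {a v : UnitAddTorus d → EuclideanSpace ℝ d}
    (hv : Torus.IsSmooth v) (x : UnitAddTorus d) :
    ‖Torus.convect a v x‖ ≤ ‖a x‖ * Real.sqrt (∑ i, ‖Torus.partialDeriv i v x‖ ^ 2) := by
  have h1 : Torus.convect a v x = ∑ i, (a x) i • Torus.partialDeriv i v x :=
    Torus.fderiv_apply_eq_sum_partialDeriv (hv.isContDiff (by simp)) x (a x)
  rw [h1]
  calc ‖∑ i, (a x) i • Torus.partialDeriv i v x‖
      ≤ ∑ i, ‖(a x) i • Torus.partialDeriv i v x‖ := norm_sum_le _ _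
    _ = ∑ i, |(a x) i| * ‖Torus.partialDeriv i v x‖ := by
        refine Finset.sum_congr rfl fun i _ => ?_
        rw [norm_smul, Real.norm_eq_abs]
    _ ≤ Real.sqrt (∑ i, |(a x) i| ^ 2) * Real.sqrt (∑ i, ‖Torus.partialDeriv i v x‖ ^ 2) :=
        Real.sum_mul_le_sqrt_mul_sqrt _ _ _
    _ = ‖a x‖ * Real.sqrt (∑ i, ‖Torus.partialDeriv i v x‖ ^ 2) := by
        rw [EuclideanSpace.norm_eq]
        simp only [Real.norm_eq_abs]

/-- **The Laplacian of the inertial term** (Leibniz twice): for a smooth field `u` on `T^d`,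
`Δ((u·∇)u)(x) = ∑ₘ (u·∇)∂ₘ∂ₘu (x) + 2 ∑ₘ (∂ₘu·∇)∂ₘu (x) + (Δu·∇)u (x)`. [folklore] -/
private theorem laplacian_convect_self_apply {u : UnitAddTorus d → EuclideanSpace ℝ d}
    (hu : Torus.IsSmooth u) (x : UnitAddTorus d) :
    Torus.laplacian (Torus.convect u u) x =
      ∑ m, Torus.convect u (Torus.partialDeriv m (Torus.partialDeriv m u)) x +
        (2 : ℝ) • ∑ m, Torus.convect (Torus.partialDeriv m u) (Torus.partialDeriv m u) x +
        Torus.convect (Torus.laplacian u) u x := by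
  have hB : Torus.IsSmooth (Torus.convect u u) := hu.convect hu
  have hD : ∀ m, Torus.IsSmooth (Torus.partialDeriv m u) := fun m => hu.partialDeriv m
  -- `∂ₘ B = (u·∇)∂ₘu + (∂ₘu·∇)u` as functions
  have h1 : ∀ m, Torus.partialDeriv m (Torus.convect u u) =
      Torus.convect u (Torus.partialDeriv m u) + Torus.convect (Torus.partialDeriv m u) u := by
    intro m; funext y
    rw [Pi.add_apply]
    exact Torus.partialDeriv_convect_eq_add_convect hu hu m y
  -- second derivative
  have h2 : ∀ m, Torus.partialDeriv m (Torus.partialDeriv m (Torus.convect u u)) x =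
      Torus.convect u (Torus.partialDeriv m (Torus.partialDeriv m u)) x +
        (2 : ℝ) • Torus.convect (Torus.partialDeriv m u) (Torus.partialDeriv m u) x +
        Torus.convect (Torus.partialDeriv m (Torus.partialDeriv m u)) u x := by
    intro m
    have hs1 : Torus.IsSmooth (Torus.convect u (Torus.partialDeriv m u)) := hu.convect (hD m)
    have hs2 : Torus.IsSmooth (Torus.convect (Torus.partialDeriv m u) u) := (hD m).convect hu
    rw [h1 m, Torus.partialDeriv_add (hs1.isContDiff (by simp)) (hs2.isContDiff (by simp)),
      Pi.add_apply, Torus.partialDeriv_convect_eq_add_convect hu (hD m) m x,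
      Torus.partialDeriv_convect_eq_add_convect (hD m) hu m x, two_smul]
    abel
  rw [Torus.laplacian_eq_sum_partialDeriv_partialDeriv hB x]
  simp_rw [h2]
  rw [Finset.sum_add_distrib, Finset.sum_add_distrib, Finset.smul_sum]
  congr 1
  -- `∑ₘ (∂ₘ∂ₘu·∇)u = (Δu·∇)u` (linearity in the transporting field)
  simp only [Torus.convect]
  rw [← map_sum]
  congr 1
  rw [Torus.laplacian_eq_sum_partialDeriv_partialDeriv hu x]

/-- `∑ₘ (u·∇)∂ₘ∂ₘu (x) = (u·∇)Δu (x)` (`Dv(x)h = ∑ᵢ hᵢ∂ᵢv(x)` and `∂ᵢΔu = ∑ₘ ∂ᵢ∂ₘ∂ₘu`). [folklore] -/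
private theorem sum_convect_partialDeriv_partialDeriv_eq {u : UnitAddTorus d → EuclideanSpace ℝ d}
    (hu : Torus.IsSmooth u) (x : UnitAddTorus d) :
    ∑ m, Torus.convect u (Torus.partialDeriv m (Torus.partialDeriv m u)) x =
      Torus.convect u (Torus.laplacian u) x := by
  have hDD : ∀ m, Torus.IsSmooth (Torus.partialDeriv m (Torus.partialDeriv m u)) :=
    fun m => (hu.partialDeriv m).partialDeriv m
  have hΔfun : Torus.laplacian u = fun y => ∑ m, Torus.partialDeriv m (Torus.partialDeriv m u) y := by
    funext y; exact Torus.laplacian_eq_sum_partialDeriv_partialDeriv hu y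
  simp only [Torus.convect]
  rw [Torus.fderiv_apply_eq_sum_partialDeriv (hu.laplacian.isContDiff (by simp)) x (u x)]
  simp_rw [Torus.fderiv_apply_eq_sum_partialDeriv ((hDD _).isContDiff (by simp)) x (u x)]
  rw [Finset.sum_comm]
  refine Finset.sum_congr rfl fun i _ => ?_
  rw [← Finset.smul_sum]
  congr 1
  rw [hΔfun, Torus.partialDeriv_finset_sum _ (fun m _ => (hDD m).isContDiff (by simp))]

/-! ## The static bound on the `H²` nonlinear term (Doering–Gibbon Steps 1–2 at `N = 2`) -/

/-- **The `H²` nonlinear term against the sup of the velocity gradient** (Doering–Gibbon 1995, §6.2,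
proof of Thm 6.1, Steps 1–2, eq. (6.2.25) `|NL term| ≤ c_N H_N ‖Du‖_∞` at `N = 2`, with the
dimensionless constant made explicit, `c₂ = 3`, in the Frobenius normalisation of `‖Du‖_∞`): for a
smooth divergence-free vector field `v` on `T^d` (any `d`) with `∑ᵢ‖∂ᵢv(x)‖² ≤ M²` for all `x`
(`M ≥ 0`), `|∫⟪(v·∇)v, Δ²v⟫| ≤ 3 M ∫‖Δv‖²`. Proof as printed: Green `∫⟪(v·∇)v, Δ²v⟫ = ∫⟪Δ((v·∇)v), Δv⟫`,
Leibniz `Δ((v·∇)v) = (v·∇)Δv + 2∑ₘ(∂ₘv·∇)∂ₘv + (Δv·∇)v`, the transport term integrates to `0`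
against `Δv` (`div v = 0`), the other two are bounded pointwise by `M |∇²v|_F ‖Δv‖` and `M ‖Δv‖²`,
then Cauchy–Schwarz in `L²` and `‖∇²v‖₂ = ‖Δv‖₂` on the torus.
[cite: DoeringGibbon1995, §6.2, proof of Thm 6.1, Step 2, eq. (6.2.25) (N = 2)] -/
theorem _root_.Literature.Analysis.FunctionSpaces.Torus.abs_integral_inner_convect_bilaplacian_le
    {v : UnitAddTorus d → EuclideanSpace ℝ d} (hut : Torus.IsSmooth v) (hdiv : Torus.IsDivFree v)
    {M : ℝ} (hM0 : 0 ≤ M) (hM : ∀ x, ∑ i, ‖Torus.partialDeriv i v x‖ ^ 2 ≤ M ^ 2) :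
    |∫ x, ⟪Torus.convect v v x, Torus.laplacian (Torus.laplacian v) x⟫_ℝ| ≤
      3 * M * ∫ x, ‖Torus.laplacian v x‖ ^ 2 := by
  have hB : Torus.IsSmooth (Torus.convect v v) := hut.convect hut
  have hΔ : Torus.IsSmooth (Torus.laplacian v) := hut.laplacian
  have hD : ∀ m, Torus.IsSmooth (Torus.partialDeriv m v) := fun m => hut.partialDeriv m
  have hDD : ∀ i m, Torus.IsSmooth (Torus.partialDeriv i (Torus.partialDeriv m v)) :=
    fun i m => (hD m).partialDeriv i
  -- ### Green
  have hN : ∫ x, ⟪Torus.convect v v x, Torus.laplacian (Torus.laplacian v) x⟫_ℝ =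
      ∫ x, ⟪Torus.laplacian (Torus.convect v v) x, Torus.laplacian v x⟫_ℝ :=
    (Torus.integral_inner_laplacian_comm hB hΔ).symm
  -- the three pieces of `⟪ΔB, Δv⟫`
  set P1 : UnitAddTorus d → ℝ := fun x => ⟪Torus.convect v (Torus.laplacian v) x, Torus.laplacian v x⟫_ℝ
    with hP1
  set P2 : UnitAddTorus d → ℝ := fun x =>
    ∑ m, ⟪Torus.convect (Torus.partialDeriv m v) (Torus.partialDeriv m v) x, Torus.laplacian v x⟫_ℝ
    with hP2
  set P3 : UnitAddTorus d → ℝ := fun x => ⟪Torus.convect (Torus.laplacian v) v x, Torus.laplacian v x⟫_ℝ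
    with hP3
  have hsplit : ∀ x, ⟪Torus.laplacian (Torus.convect v v) x, Torus.laplacian v x⟫_ℝ =
      P1 x + 2 * P2 x + P3 x := by
    intro x
    rw [laplacian_convect_self_apply hut x, sum_convect_partialDeriv_partialDeriv_eq hut x,
      inner_add_left, inner_add_left, hP1, hP2, hP3]
    simp only
    rw [real_inner_smul_left, sum_inner]
  have hc1 : Continuous P1 := (hut.convect hΔ).continuous.inner hΔ.continuous
  have hc2 : Continuous P2 :=
    continuous_finsetSum _ fun m _ => ((hD m).convect (hD m)).continuous.inner hΔ.continuous
  have hc3 : Continuous P3 := (hΔ.convect hut).continuous.inner hΔ.continuous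
  have i1 : Integrable (fun x => P1 x + 2 * P2 x) :=
    (hc1.add (continuous_const.mul hc2)).integrable_unitAddTorus
  have i2 : Integrable P3 := hc3.integrable_unitAddTorus
  have i3 : Integrable P1 := hc1.integrable_unitAddTorus
  have i4 : Integrable (fun x => 2 * P2 x) := (continuous_const.mul hc2).integrable_unitAddTorus
  have hI : ∫ x, ⟪Torus.laplacian (Torus.convect v v) x, Torus.laplacian v x⟫_ℝ =
      (∫ x, P1 x) + 2 * (∫ x, P2 x) + ∫ x, P3 x := by
    rw [integral_congr_ae (Filter.Eventually.of_forall hsplit)]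
    change ∫ x, ((P1 x + 2 * P2 x) + P3 x) = _
    rw [integral_add i1 i2, integral_add i3 i4, integral_const_mul]
  -- ### Step 3: the transport term vanishes
  have hP1z : ∫ x, P1 x = 0 := Torus.integral_inner_convect_self_right_eq_zero hut hdiv hΔ
  -- ### Step 4: pointwise bounds
  set g : UnitAddTorus d → ℝ := fun x =>
    Real.sqrt (∑ m, ∑ i, ‖Torus.partialDeriv i (Torus.partialDeriv m v) x‖ ^ 2) with hg
  set h : UnitAddTorus d → ℝ := fun x => ‖Torus.laplacian v x‖ with hh
  have hg0 : ∀ x, 0 ≤ g x := fun x => Real.sqrt_nonneg _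
  have hh0 : ∀ x, 0 ≤ h x := fun x => norm_nonneg _
  have hMx : ∀ x, Real.sqrt (∑ i, ‖Torus.partialDeriv i v x‖ ^ 2) ≤ M := fun x => by
    rw [← Real.sqrt_sq hM0]; exact Real.sqrt_le_sqrt (hM x)
  have hP2le : ∀ x, |P2 x| ≤ M * (g x * h x) := by
    intro x
    have hterm : ∀ m, |⟪Torus.convect (Torus.partialDeriv m v) (Torus.partialDeriv m v) x,
        Torus.laplacian v x⟫_ℝ| ≤ ‖Torus.partialDeriv m v x‖ *
          Real.sqrt (∑ i, ‖Torus.partialDeriv i (Torus.partialDeriv m v) x‖ ^ 2) * h x := by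
      intro m
      refine (abs_real_inner_le_norm _ _).trans ?_
      exact mul_le_mul_of_nonneg_right (norm_convect_le_norm_mul_sqrt' (hD m) x) (norm_nonneg _)
    calc |P2 x| ≤ ∑ m, |⟪Torus.convect (Torus.partialDeriv m v) (Torus.partialDeriv m v) x,
          Torus.laplacian v x⟫_ℝ| := Finset.abs_sum_le_sum_abs _ _
      _ ≤ ∑ m, ‖Torus.partialDeriv m v x‖ *
            Real.sqrt (∑ i, ‖Torus.partialDeriv i (Torus.partialDeriv m v) x‖ ^ 2) * h x :=
          Finset.sum_le_sum fun m _ => hterm m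
      _ = (∑ m, ‖Torus.partialDeriv m v x‖ *
            Real.sqrt (∑ i, ‖Torus.partialDeriv i (Torus.partialDeriv m v) x‖ ^ 2)) * h x := by
          rw [Finset.sum_mul]
      _ ≤ (Real.sqrt (∑ m, ‖Torus.partialDeriv m v x‖ ^ 2) *
            Real.sqrt (∑ m, Real.sqrt (∑ i, ‖Torus.partialDeriv i (Torus.partialDeriv m v) x‖ ^ 2) ^ 2))
            * h x :=
          mul_le_mul_of_nonneg_right (Real.sum_mul_le_sqrt_mul_sqrt _ _ _) (hh0 x)
      _ ≤ (M * g x) * h x := by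
          refine mul_le_mul_of_nonneg_right ?_ (hh0 x)
          have e : Real.sqrt (∑ m, Real.sqrt (∑ i, ‖Torus.partialDeriv i (Torus.partialDeriv m v) x‖ ^ 2) ^ 2)
              = g x := by
            rw [hg]
            congr 1
            exact Finset.sum_congr rfl fun m _ => Real.sq_sqrt (Finset.sum_nonneg fun i _ => sq_nonneg _)
          rw [e]
          exact mul_le_mul_of_nonneg_right (hMx x) (hg0 x)
      _ = M * (g x * h x) := by ring
  have hP3le : ∀ x, |P3 x| ≤ M * h x ^ 2 := by
    intro x
    calc |P3 x| ≤ ‖Torus.convect (Torus.laplacian v) v x‖ * ‖Torus.laplacian v x‖ :=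
          abs_real_inner_le_norm _ _
      _ ≤ (‖Torus.laplacian v x‖ * Real.sqrt (∑ i, ‖Torus.partialDeriv i v x‖ ^ 2)) *
            ‖Torus.laplacian v x‖ :=
          mul_le_mul_of_nonneg_right (norm_convect_le_norm_mul_sqrt' hut x) (norm_nonneg _)
      _ ≤ (‖Torus.laplacian v x‖ * M) * ‖Torus.laplacian v x‖ :=
          mul_le_mul_of_nonneg_right (mul_le_mul_of_nonneg_left (hMx x) (norm_nonneg _))
            (norm_nonneg _)
      _ = M * h x ^ 2 := by rw [hh]; ring
  -- ### Step 5: integrate; Cauchy–Schwarz and `‖∇²v‖₂ = ‖Δv‖₂`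
  have hgc : Continuous g := by
    refine Continuous.sqrt (continuous_finsetSum _ fun m _ => continuous_finsetSum _ fun i _ => ?_)
    exact ((hDD i m).continuous.norm).pow 2
  have hhc : Continuous h := hΔ.continuous.norm
  have hgm : MemLp g (ENNReal.ofReal 2) volume :=
    hgc.memLp_of_hasCompactSupport (HasCompactSupport.of_compactSpace g)
  have hhm : MemLp h (ENNReal.ofReal 2) volume :=
    hhc.memLp_of_hasCompactSupport (HasCompactSupport.of_compactSpace h)
  have hcs := integral_mul_le_Lp_mul_Lq_of_nonneg (μ := volume) Real.HolderConjugate.two_two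
    (ae_of_all _ hg0) (ae_of_all _ hh0) hgm hhm
  have hH : ∫ x, ‖Torus.laplacian v x‖ ^ 2 = ∫ x, h x ^ 2 := rfl
  have e1 : ∫ x, g x ^ (2 : ℝ) = ∫ x, ‖Torus.laplacian v x‖ ^ 2 := by
    rw [← Torus.integral_sum_sum_norm_partialDeriv_partialDeriv_sq_eq hut]
    exact integral_congr_ae (ae_of_all _ fun x => by
      dsimp only
      rw [Real.rpow_two, hg, Real.sq_sqrt (Finset.sum_nonneg fun m _ =>
        Finset.sum_nonneg fun i _ => sq_nonneg _)])
  have e2 : ∫ x, h x ^ (2 : ℝ) = ∫ x, ‖Torus.laplacian v x‖ ^ 2 :=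
    integral_congr_ae (ae_of_all _ fun x => by dsimp only; rw [Real.rpow_two])
  rw [e1, e2] at hcs
  have hH0 : 0 ≤ ∫ x, ‖Torus.laplacian v x‖ ^ 2 := by positivity
  have hgh : ∫ x, g x * h x ≤ ∫ x, ‖Torus.laplacian v x‖ ^ 2 := by
    refine hcs.trans (le_of_eq ?_)
    rw [← Real.sqrt_eq_rpow, Real.mul_self_sqrt hH0]
  have hI2 : |∫ x, P2 x| ≤ M * ∫ x, ‖Torus.laplacian v x‖ ^ 2 := by
    calc |∫ x, P2 x| ≤ ∫ x, |P2 x| := abs_integral_le_integral_abs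
      _ ≤ ∫ x, M * (g x * h x) :=
          integral_mono hc2.integrable_unitAddTorus.abs
            ((hgc.mul hhc).integrable_unitAddTorus.const_mul M) hP2le
      _ = M * ∫ x, g x * h x := integral_const_mul _ _
      _ ≤ M * ∫ x, ‖Torus.laplacian v x‖ ^ 2 := mul_le_mul_of_nonneg_left hgh hM0
  have hI3 : |∫ x, P3 x| ≤ M * ∫ x, ‖Torus.laplacian v x‖ ^ 2 := by
    calc |∫ x, P3 x| ≤ ∫ x, |P3 x| := abs_integral_le_integral_abs
      _ ≤ ∫ x, M * h x ^ 2 :=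
          integral_mono hc3.integrable_unitAddTorus.abs
            ((hhc.pow 2).integrable_unitAddTorus.const_mul M) hP3le
      _ = M * ∫ x, ‖Torus.laplacian v x‖ ^ 2 := by rw [integral_const_mul, hH]
  -- ### assembly
  rw [hN, hI, hP1z, zero_add, abs_le]
  have h2 := abs_le.1 hI2
  have h3 := abs_le.1 hI3
  constructor <;> nlinarith [h2.1, h2.2, h3.1, h3.2]

/-! ## Interpolation `H₂² ≤ H₁ H₃` (Doering–Gibbon Lemma 6.2 at `N = 2`) -/

/-- Green's first identity in bilinear form on the torus: `∫⟪Δa, b⟫ = −∑ᵢ ∫⟪∂ᵢa, ∂ᵢb⟫` for smooth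
vector fields (the computation inside `Torus.integral_inner_laplacian_comm`). [folklore] -/
private theorem integral_inner_laplacian_eq_neg_sum {a b : UnitAddTorus d → EuclideanSpace ℝ d}
    (ha : Torus.IsSmooth a) (hb : Torus.IsSmooth b) :
    ∫ x, ⟪Torus.laplacian a x, b x⟫_ℝ =
      -∑ i, ∫ x, ⟪Torus.partialDeriv i a x, Torus.partialDeriv i b x⟫_ℝ := by
  simp_rw [Torus.laplacian_eq_sum_partialDeriv_partialDeriv ha, sum_inner]
  rw [integral_finsetSum _ fun i _ =>
      (((ha.partialDeriv i).partialDeriv i).inner hb).integrable,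
    ← Finset.sum_neg_distrib]
  exact Finset.sum_congr rfl fun i _ =>
    Torus.integral_inner_partialDeriv_eq_neg (ha.partialDeriv i) hb i

/-- **Interpolation `‖Δv‖₂⁴ ≤ ‖∇v‖₂² ‖∇Δv‖₂²`** (Doering–Gibbon 1995, §6.2, Lemma 6.2, Step A,
eqs. (6.2.30)–(6.2.31) `M_N ≤ M_{N+1}^{1/2} M_{N−1}^{1/2}` at `N = 2`: `H₂ ≤ H₁^{1/2} H₃^{1/2}` with
`H₁ = ‖∇v‖₂² = Torus.gradNormSq v`, `H₂ = ∫∑ᵢ∑ⱼ‖∂ᵢ∂ⱼv‖² = ‖Δv‖₂²`, `H₃ = ‖∇Δv‖₂² = Torus.gradNormSq (Δv)`),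
for every smooth vector field on `T^d` (any `d`): one integration by parts
`∫‖Δv‖² = −∑ᵢ∫⟪∂ᵢv, ∂ᵢΔv⟫` and the Cauchy–Schwarz inequality, exactly as printed.
[cite: DoeringGibbon1995, §6.2 Lemma 6.2, eqs. (6.2.30)–(6.2.31) (N = 2)] -/
theorem _root_.Literature.Analysis.FunctionSpaces.Torus.sq_integral_norm_sq_laplacian_le
    {v : UnitAddTorus d → EuclideanSpace ℝ d} (hv : Torus.IsSmooth v) :
    (∫ x, ‖Torus.laplacian v x‖ ^ 2) ^ 2 ≤
      Torus.gradNormSq v * Torus.gradNormSq (Torus.laplacian v) := by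
  have hΔ : Torus.IsSmooth (Torus.laplacian v) := hv.laplacian
  have hD : ∀ i, Torus.IsSmooth (Torus.partialDeriv i v) := fun i => hv.partialDeriv i
  have hDΔ : ∀ i, Torus.IsSmooth (Torus.partialDeriv i (Torus.laplacian v)) :=
    fun i => hΔ.partialDeriv i
  set Q : UnitAddTorus d → ℝ := fun x =>
    ∑ i, ⟪Torus.partialDeriv i v x, Torus.partialDeriv i (Torus.laplacian v) x⟫_ℝ with hQ
  set g : UnitAddTorus d → ℝ := fun x => Real.sqrt (∑ i, ‖Torus.partialDeriv i v x‖ ^ 2) with hg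
  set h : UnitAddTorus d → ℝ := fun x =>
    Real.sqrt (∑ i, ‖Torus.partialDeriv i (Torus.laplacian v) x‖ ^ 2) with hh
  -- ### integration by parts: `‖Δv‖₂² = -∫ Q`
  have hP : ∫ x, ‖Torus.laplacian v x‖ ^ 2 = -∫ x, Q x := by
    have e1 : ∫ x, ‖Torus.laplacian v x‖ ^ 2 = ∫ x, ⟪Torus.laplacian v x, Torus.laplacian v x⟫_ℝ :=
      integral_congr_ae (ae_of_all _ fun x => (real_inner_self_eq_norm_sq _).symm)
    rw [e1, integral_inner_laplacian_eq_neg_sum hv hΔ, hQ,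
      integral_finsetSum _ fun i _ => ((hD i).inner (hDΔ i)).integrable]
  -- ### pointwise Cauchy–Schwarz
  have hg0 : ∀ x, 0 ≤ g x := fun x => Real.sqrt_nonneg _
  have hh0 : ∀ x, 0 ≤ h x := fun x => Real.sqrt_nonneg _
  have hQle : ∀ x, |Q x| ≤ g x * h x := fun x =>
    calc |Q x| ≤ ∑ i, |⟪Torus.partialDeriv i v x, Torus.partialDeriv i (Torus.laplacian v) x⟫_ℝ| :=
          Finset.abs_sum_le_sum_abs _ _
      _ ≤ ∑ i, ‖Torus.partialDeriv i v x‖ * ‖Torus.partialDeriv i (Torus.laplacian v) x‖ :=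
          Finset.sum_le_sum fun i _ => abs_real_inner_le_norm _ _
      _ ≤ g x * h x := Real.sum_mul_le_sqrt_mul_sqrt _ _ _
  -- ### `L²` Cauchy–Schwarz
  have hQc : Continuous Q :=
    continuous_finsetSum _ fun i _ => (hD i).continuous.inner (hDΔ i).continuous
  have hgc : Continuous g :=
    Continuous.sqrt (continuous_finsetSum _ fun i _ => ((hD i).continuous.norm).pow 2)
  have hhc : Continuous h :=
    Continuous.sqrt (continuous_finsetSum _ fun i _ => ((hDΔ i).continuous.norm).pow 2)
  have hgm : MemLp g (ENNReal.ofReal 2) volume :=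
    hgc.memLp_of_hasCompactSupport (HasCompactSupport.of_compactSpace g)
  have hhm : MemLp h (ENNReal.ofReal 2) volume :=
    hhc.memLp_of_hasCompactSupport (HasCompactSupport.of_compactSpace h)
  have hcs := integral_mul_le_Lp_mul_Lq_of_nonneg (μ := volume) Real.HolderConjugate.two_two
    (ae_of_all _ hg0) (ae_of_all _ hh0) hgm hhm
  have e1 : ∫ x, g x ^ (2 : ℝ) = Torus.gradNormSq v := by
    rw [Torus.gradNormSq]
    exact integral_congr_ae (ae_of_all _ fun x => by
      dsimp only
      rw [Real.rpow_two, hg, Real.sq_sqrt (Finset.sum_nonneg fun i _ => sq_nonneg _)])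
  have e2 : ∫ x, h x ^ (2 : ℝ) = Torus.gradNormSq (Torus.laplacian v) := by
    rw [Torus.gradNormSq]
    exact integral_congr_ae (ae_of_all _ fun x => by
      dsimp only
      rw [Real.rpow_two, hh, Real.sq_sqrt (Finset.sum_nonneg fun i _ => sq_nonneg _)])
  rw [e1, e2, ← Real.sqrt_eq_rpow, ← Real.sqrt_eq_rpow] at hcs
  have hPle : ∫ x, ‖Torus.laplacian v x‖ ^ 2 ≤
      Real.sqrt (Torus.gradNormSq v) * Real.sqrt (Torus.gradNormSq (Torus.laplacian v)) := by
    rw [hP]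
    calc -∫ x, Q x ≤ |∫ x, Q x| := neg_le_abs _
      _ ≤ ∫ x, |Q x| := abs_integral_le_integral_abs
      _ ≤ ∫ x, g x * h x :=
          integral_mono hQc.integrable_unitAddTorus.abs (hgc.mul hhc).integrable_unitAddTorus hQle
      _ ≤ _ := hcs
  have hP0 : 0 ≤ ∫ x, ‖Torus.laplacian v x‖ ^ 2 := integral_nonneg fun _ => sq_nonneg _
  calc (∫ x, ‖Torus.laplacian v x‖ ^ 2) ^ 2
      ≤ (Real.sqrt (Torus.gradNormSq v) * Real.sqrt (Torus.gradNormSq (Torus.laplacian v))) ^ 2 :=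
        pow_le_pow_left₀ hP0 hPle 2
    _ = Torus.gradNormSq v * Torus.gradNormSq (Torus.laplacian v) := by
        rw [mul_pow, Real.sq_sqrt (Torus.gradNormSq_nonneg _), Real.sq_sqrt (Torus.gradNormSq_nonneg _)]

/-! ## Agmon for the velocity gradient on `T³`, explicit constant -/

/-- **Agmon's inequality for the velocity gradient on `T³` with the explicit constant `2/π²`**: for a
smooth vector field `v` on `T^d`, `card d = 3`, and every point `x`,
`∑ᵢ ‖∂ᵢv(x)‖² ≤ (2/π²) ‖Δv‖₂ ‖∇Δv‖₂` (`‖∇Δv‖₂² = Torus.gradNormSq (Δv)`). This is Agmon's inequality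
`‖w‖²_∞ ≤ (2/π²)‖∇w‖₂‖Δw‖₂` for zero-mean `w` on `T³` (Ayala 2014 App. A (A.3), squared; in tree
`Torus.norm_sq_le_two_div_pi_sq_mul_sqrt`) applied to the zero-mean fields `w = ∂ᵢv`
(`Torus.hasZeroMean_partialDeriv`), summed over `i` with the Cauchy–Schwarz inequality, and the torus
identities `∑ᵢ‖∇∂ᵢv‖₂² = ‖Δv‖₂²`, `∑ᵢ‖Δ∂ᵢv‖₂² = ‖∇Δv‖₂²` — the `‖Du‖_∞`-interpolation step that closes
the `N = 2` rung of the Doering–Gibbon ladder in `d = 3`, with the constant explicit.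
[cite: Ayala2014Thesis, App. A (A.3)] -/
theorem _root_.Literature.Analysis.FunctionSpaces.Torus.sum_norm_sq_partialDeriv_le_agmon_explicit
    (hd : Fintype.card d = 3) {v : UnitAddTorus d → EuclideanSpace ℝ d} (hv : Torus.IsSmooth v)
    (x : UnitAddTorus d) :
    ∑ i, ‖Torus.partialDeriv i v x‖ ^ 2 ≤
      2 / π ^ 2 * Real.sqrt (∫ y, ‖Torus.laplacian v y‖ ^ 2) *
        Real.sqrt (Torus.gradNormSq (Torus.laplacian v)) := by
  have hD : ∀ i, Torus.IsSmooth (Torus.partialDeriv i v) := fun i => hv.partialDeriv i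
  have hi : ∀ i, ‖Torus.partialDeriv i v x‖ ^ 2 ≤ 2 / π ^ 2 *
      Real.sqrt (Torus.gradNormSq (Torus.partialDeriv i v)) *
        Real.sqrt (∫ y, ‖Torus.laplacian (Torus.partialDeriv i v) y‖ ^ 2) := fun i =>
    Torus.norm_sq_le_two_div_pi_sq_mul_sqrt hd (hD i) (Torus.hasZeroMean_partialDeriv hv i) x
  -- `∑ᵢ ‖∇∂ᵢv‖₂² = ‖Δv‖₂²`
  have hint : ∀ m, Integrable (fun y => ∑ i, ‖Torus.partialDeriv i (Torus.partialDeriv m v) y‖ ^ 2) :=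
    fun m => (continuous_finsetSum _ fun i _ =>
      (((hD m).partialDeriv i).continuous.norm).pow 2).integrable_unitAddTorus
  have hA : ∑ m, Torus.gradNormSq (Torus.partialDeriv m v) = ∫ y, ‖Torus.laplacian v y‖ ^ 2 := by
    have e := Torus.integral_sum_sum_norm_partialDeriv_partialDeriv_sq_eq hv
    rw [integral_finsetSum _ fun m _ => hint m] at e
    simpa only [Torus.gradNormSq] using e
  -- `∑ᵢ ‖Δ∂ᵢv‖₂² = ‖∇Δv‖₂²`
  have hB : ∑ m, ∫ y, ‖Torus.laplacian (Torus.partialDeriv m v) y‖ ^ 2 =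
      Torus.gradNormSq (Torus.laplacian v) := (Torus.gradNormSq_laplacian_eq_sum hv).symm
  have hc : 0 ≤ 2 / π ^ 2 := by positivity
  calc ∑ i, ‖Torus.partialDeriv i v x‖ ^ 2
      ≤ ∑ i, 2 / π ^ 2 * Real.sqrt (Torus.gradNormSq (Torus.partialDeriv i v)) *
          Real.sqrt (∫ y, ‖Torus.laplacian (Torus.partialDeriv i v) y‖ ^ 2) :=
        Finset.sum_le_sum fun i _ => hi i
    _ = 2 / π ^ 2 * ∑ i, Real.sqrt (Torus.gradNormSq (Torus.partialDeriv i v)) *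
          Real.sqrt (∫ y, ‖Torus.laplacian (Torus.partialDeriv i v) y‖ ^ 2) := by
        rw [Finset.mul_sum]
        exact Finset.sum_congr rfl fun i _ => by ring
    _ ≤ 2 / π ^ 2 * (Real.sqrt (∑ i, Real.sqrt (Torus.gradNormSq (Torus.partialDeriv i v)) ^ 2) *
          Real.sqrt (∑ i, Real.sqrt (∫ y, ‖Torus.laplacian (Torus.partialDeriv i v) y‖ ^ 2) ^ 2)) :=
        mul_le_mul_of_nonneg_left (Real.sum_mul_le_sqrt_mul_sqrt _ _ _) hc
    _ = 2 / π ^ 2 * Real.sqrt (∫ y, ‖Torus.laplacian v y‖ ^ 2) *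
          Real.sqrt (Torus.gradNormSq (Torus.laplacian v)) := by
        rw [← hA, ← hB, mul_assoc]
        congr 2
        · congr 1
          exact Finset.sum_congr rfl fun i _ => Real.sq_sqrt (Torus.gradNormSq_nonneg _)
        · congr 1
          exact Finset.sum_congr rfl fun i _ =>
            Real.sq_sqrt (integral_nonneg fun _ => sq_nonneg _)

/-! ## The `N = 2` rung -/

/-- **Doering–Gibbon ladder, rung `N = 2`, on the torus with the constant made explicit**
(Doering–Gibbon 1995, Thm 6.1, proof Step 5, eq. (6.2.27): `½Ḣ_N ≤ −νH_{N+1} + c_N‖Du‖_∞H_N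
+ H_N^{1/2}Φ_N^{1/2}`; here `N = 2`, no forcing, `c₂ = 3` in the Frobenius normalisation of
`‖Du‖_∞`): along a classical solution of the unforced Navier–Stokes system on `T^d × [a, b]`,
`a < b`, at a time `t` where `∑ᵢ‖∂ᵢu(t,x)‖² ≤ M²` for all `x` (`M ≥ 0`), every one-sided derivative
`R` of `s ↦ ½ ∫‖Δu(s)‖²` within `[a, b]` satisfies
`R ≤ −ν ‖∇Δu(t)‖₂² + 3 M ∫‖Δu(t)‖²` (`‖∇Δu‖₂² = Torus.gradNormSq (Δu)`).
[cite: DoeringGibbon1995, §6.2, proof of Thm 6.1, Step 5, eq. (6.2.27) (N = 2, Φ = 0)] -/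
theorem _root_.Literature.Analysis.FunctionSpaces.Torus.IsClassicalNSSolutionOn.halfLaplacianSqRate_le_of_gradient_bound
    {ν a b : ℝ} (hab : a < b)
    {u : ℝ → UnitAddTorus d → EuclideanSpace ℝ d} {p : ℝ → UnitAddTorus d → ℝ}
    (hsol : Torus.IsClassicalNSSolutionOn (Icc a b) ν 0 u p) {t : ℝ} (ht : t ∈ Icc a b)
    {M : ℝ} (hM0 : 0 ≤ M) (hM : ∀ x, ∑ i, ‖Torus.partialDeriv i (u t) x‖ ^ 2 ≤ M ^ 2) {R : ℝ}
    (hR : HasDerivWithinAt (fun s => 2⁻¹ * ∫ x, ‖Torus.laplacian (u s) x‖ ^ 2) R (Icc a b) t) :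
    R ≤ -ν * Torus.gradNormSq (Torus.laplacian (u t)) +
      3 * M * ∫ x, ‖Torus.laplacian (u t) x‖ ^ 2 := by
  have hut : Torus.IsSmooth (u t) := hsol.smooth_velocity.isSmooth_slice ht
  have hdiv : Torus.IsDivFree (u t) := hsol.divFree t ht
  -- ### Step 1: identify `R` with the `H²` balance rate (`n = 1`)
  have hbal := hsol.hasDerivWithinAt_half_integral_norm_sq_laplacian_iterate hab 1 ht
  simp only [Nat.mul_one, Function.iterate_succ, Function.iterate_zero, Function.comp_apply,
    Function.id_comp, id_eq] at hbal
  have hU : UniqueDiffWithinAt ℝ (Icc a b) t := uniqueDiffOn_Icc hab t ht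
  have hReq : R = -ν * Torus.gradNormSq (Torus.laplacian (u t)) -
      ∫ x, ⟪Torus.convect (u t) (u t) x - (0 : ℝ → UnitAddTorus d → EuclideanSpace ℝ d) t x,
        Torus.laplacian (Torus.laplacian (u t)) x⟫_ℝ :=
    (hR.derivWithin hU).symm.trans (hbal.derivWithin hU)
  have hz : ∫ x, ⟪Torus.convect (u t) (u t) x - (0 : ℝ → UnitAddTorus d → EuclideanSpace ℝ d) t x,
        Torus.laplacian (Torus.laplacian (u t)) x⟫_ℝ =
      ∫ x, ⟪Torus.convect (u t) (u t) x, Torus.laplacian (Torus.laplacian (u t)) x⟫_ℝ :=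
    integral_congr_ae (Filter.Eventually.of_forall fun x => by simp only [Pi.zero_apply, sub_zero])
  -- ### Steps 2–5: the static bound
  have hT := (abs_le.1 (Torus.abs_integral_inner_convect_bilaplacian_le hut hdiv hM0 hM)).1
  rw [hReq, hz]
  linarith

end Literature.Analysis.FluidPDE

end
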